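import Mathlib
import Literature.MathematicalPhysics.QuantumFieldTheory.Balaban1983to89.T4GaugeActionRate
import Literature.MathematicalPhysics.QuantumFieldTheory.Balaban1983to89.T4EtaRateMin
import Literature.MathematicalPhysics.QuantumFieldTheory.King1986.CompositionLaw
import Literature.MathematicalPhysics.QuantumFieldTheory.Balaban1983to89.Beta.SymbolExpansion

/-!
# B5 (1.62)/(1.63)/(1.66): the COMPOSITION LAWS of the primitive alias sums `φ_μ`, `ψ₂` and the η-RATE
# `L^{−2k}` of Bałaban's U(1) effective gauge-field action `⟨B, Δ_k B⟩` on the unit torus — KERNEL, by King's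
# §4 method (cell `pub-balaban`, T4-DAG node U1a, new estimate NE2 = η-rate of the LINEAR theory, layer NE2⁰:
# the object X8 = `Δ_k` of (1.65)/(1.66) and the primitive `p′`-factors of X10 = `H_k` (1.63); prover row
# T4-U1a.E-NE2-PROVE-P1)

HONEST FRAMING (cell `pub-balaban`, T4-DAG PAGE 1).  The cell's T4 target is the existence and uniqueness of the
continuum limit of Bałaban's unit-scale averaged expectations on a FINITE torus `T⁴` — no mass gap, NOT the Clay
problem.  This module concerns ONE printed linear object of the U(1) (quadratic-form) layer: the effective action
`⟨B, Δ_kB⟩` of a unit-lattice vector field `B` after `k` averaging steps, in the momentum representation (1.66) of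
[Balaban1984PropagatorsI].  Everything below is elementary real analysis on the PRINTED formulas (1.61), (1.62),
(1.66), carried out in the kernel; no named fact, no hypothesis beyond the printed ranges, no conditional of the
cell (BetaPertH, (B), (B^μ)) enters or is hidden — the U(1) linear layer needs none.  NOT summit progress.
REVISION v1.0.1 (seat P1 gen 2, 2026-08-19, DOCSTRING-ONLY): the three kernel-proved evaluations `phi162_one`,
`phi162_eq_sum_cAlias`, `psi163_eq` retagged `[folklore]` with the printed locator in prose (cross-read pv14-g11,
remark m1), and «»-hygiene of three prose lines (m2: only verbatim print inside «»); no declaration, statement or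
proof changed.

## Sources (pages read as rendered images by this seat)

* T. Bałaban, *Propagators and renormalization transformations for lattice gauge theories. I*, Commun. Math.
  Phys. **95** (1984) 17–40 [Balaban1984PropagatorsI] ("B5"), renders
  `b2b-balaban-ref1/pages/1984-cmp95-propagators-rt-I/…-p011/p012/p013/p015-x2.png` (journal pp. 27–29, 31):
  (1.61), (1.62) and the sentence «0 < γ₀ ≤ Δ₀(p′)φ_μ(p′) ≤ γ₁» p. 28, (1.65)–(1.67) p. 29 — quoted verbatim
  in the header of `B5Bounds167Lattice`, whose typed `phi162` (= (1.62)), `w166` (= the function under the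
  integral in (1.66)), `formDk` (= ⟨B,Δ_kB⟩ AS GIVEN BY the third expression of (1.66) on the unit torus
  `T₁ = Π_μ ℤ/M_μ`) and `d1Sq` (= ⟨∂₁B,∂₁B⟩) this module uses unchanged (as does the sibling module
  `T4GaugeActionRate`, whose conditional rate theorems §4 and §6 complete).  Read on render p012 (p. 28) for §6: the momentum representation (1.63) of
  `H_kB`, whose second term carries the normalising factor «(Σ_{l″} |u(p′ + l″)|² Δ₀²(p′) / Δ²(p′ + l″))⁻¹»,
  followed by «This expression is well defined and bounded for all values of l and p′, including p′ = 0 where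
  it is defined as a limit for p′ → 0.» — the sum inside that factor is the sibling's typed
  `T4GaugeActionRate.psi163`.  B5 is a manuscript UNDER AUDIT in the cell: it is quoted for what it prints,
  never as establishing a disputed step; nothing disputed is used.
* C. King, *The U(1) Higgs model. I. The continuum limit*, Commun. Math. Phys. **102** (1986) 649–677 [King1986]
  (TEMPLATE literature: a printed and proved `A = 0` mechanism, outside the audited series), renders
  `b2b-balaban-template/king-renders/1986-cmp102-king-u1-higgs-I-p022/p023/p024-x2.png` (pp. 670–672).
  p. 670: «Δ^{(k)}(p′) = (a_k⁻¹ + Σ_l |u_k^η(p′+l)|² Δ^η(p′+l)⁻¹)⁻¹. (4.5)», with «p′ ∈ [−π, π), l ∈ 2πZ^d and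
  −π(L^k − 1) ≤ l_μ ≤ π(L^k − 1) for L odd, while −πL^k ≤ l_μ ≤ πL^k for L even»;  p. 671: «To prove
  convergence of Δ^{(k)}(p′), we notice that the composition law for renormalization transformations allows us
  to write Δ^{(k+n)}(p′) in the form (4.6), with D⁻¹(p) = a_n⁻¹L^{−2k} + Σ_{l′} |u_n^{η′}(p+l′)|² Δ^{η′}(p+l′)⁻¹,
  (4.12)» and «Lemma 4.2. The operator (4.12) satisfies (4.7) and (4.8).», (4.7) being
  «|D⁻¹(p) − (|p|² + m²(L^kε)²)⁻¹| ≤ CL^{−2k}»;  p. 672: «Combining Lemmas 4.1 and 4.2 gives Lemma 4.3.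
  |Δ^{(k)}(p′) − Δ^{(k+n)}(p′)| ≤ CL^{−2k}Δ^{(k)}(p′). (4.18)».  The tree proves King's scalar statements as
  `King1986.composition_law`, `King1986.lemma42_resc`, `King1986.lemma43` (modules `CompositionRate`,
  `CompositionLaw`); this module re-uses their alias-splitting machinery (`aliasSplit`, `uFactorr_mul`,
  `Ur_mul`, `DeltaXir_mul`, `symmAlias`, `uFactorr_shift`, `Sxir_shift`) for Bałaban's VECTOR weight.

## What is NOT printed, and what this module therefore does NOT attribute to anyone

No η-comparison — with or without a rate — of Bałaban's `Δ_k`, `φ_μ`, `ψ₂`, `σ_k`, `H_k` or of the weight of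
(1.66) at two numbers of steps appears in [Balaban1984PropagatorsI] or its part II (the cell's cross-read
T4-XREAD-U1a, rows X8/X10: «none printed»); printed are the UNIFORM bounds (1.67) (certified in
`B5Bounds167Lattice.ineq167`) and the sentence «0 < γ₀ ≤ Δ₀(p′)φ_μ(p′) ≤ γ₁».  King prints and proves the rate for his
SCALAR symbol (4.5) only.  Accordingly every composition law and rate statement below is tagged [folklore]: OUR
elementary analysis of the printed formulas (1.62)/(1.63)/(1.66) along King's printed method, with OUR explicit
constants (none is attributed to either paper).

## What is proved (kernel; `N = L^k`, `R = L^n` are arbitrary naturals `≥ 1`, `d` arbitrary)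

§0 leaves (`Δ₀ = latticeSymbol 1 0`; `0 < |y|²` bookkeeping; the `n = 1` values of the `B4Strip` leaves are the
   tree's `Beta.SymbolExpansion.uFactorr_one_zero` / `DeltaXir_one_eq_Delta1r`).
§1 `phi162_one`: at one lattice (`n = 1`) (1.62) is `Δ₀(p′)⁻¹`.  `phi162_sub_inv_le` — the VECTOR LEMMA 4.2:
   for every `R ≥ 1` and `p′ ≠ 0` in `[−π,π]^d`, `|φ_μ^{(R)}(p′) − Δ₀(p′)⁻¹| ≤ π²/12 + 1/3` (upper side:
   `|v_μ|² ≤ 1` reduces to King's scalar `lemma42_resc`; lower side: the `l = 0` alias with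
   `|u(p′)|² ≥ 1 − |p′|²/12`, `|v_μ(p′)|² ≥ 1 − p′_μ²/12` and (4.7) at `η = 1`).
§2 `phi162_mul` — THE COMPOSITION LAW OF (1.62): `φ_μ^{(RN)}(p′) = Σ_{l : Fin d → Fin N} |u^{(N)}(p′+2πl)|²
   |v_μ^{(N)}(p′+2πl)|² N⁻² φ_μ^{(R)}(q̃_l/N)`, `q̃_l = King1986.symmAlias N l p′` the symmetric representative
   (`cAlias N l p′ = q̃_l/N ∈ [−π,π]^d`, `abs_cAlias_le`); ingredients `phiSum` (the alias sum at any real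
   momentum), its `2π`-periodicity `phiSum_periodic`, `phiSum_cAlias`.
§3 `phi162_rate` — the VECTOR LEMMA 4.3: `|φ_μ^{(RN)}(p′) − φ_μ^{(N)}(p′)| ≤ (π²/12 + 1/3)·N⁻²` on the punctured
   zone, uniformly in `R`, `d`, `μ` (`Cphi = π²/12 + 1/3`; proof = King's: the composition law, `Σ_l|u|² = 1`,
   `|v_μ|² ≤ 1`, and the vector Lemma 4.2 at each `q̃_l/N`); `Delta0_phi162_rate`.
§4 THE SIBLING MODULE'S HYPOTHESIS DISCHARGED.  `T4GaugeActionRate` (seat P2 of the same node) proves, for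
   Bałaban's weight (1.66) and form ⟨B,Δ_kB⟩, King's (3.91)/(3.92)-shape rate and the `k → ∞` limits GIVEN the
   one explicit hypothesis `hφ` = a rate of the `d` primitive alias sums `Δ₀φ_κ`; `hphi_discharged` /
   `hphi_king_shape` ARE that hypothesis, as theorems (`|Δ₀φ_κ^{(N)} − Δ₀φ_κ^{(RN)}| ≤ 4d(π²/12 + 1/3)N⁻²`, resp.
   `C_φ = 4d(π²/12 + 1/3)` in the `(L^k, L^{k+m})` indexing).  Hence, BY NAME and with no hypothesis left:
   `w166_rate` (`|w^{(N)} − w^{(RN)}| ≤ Crate(d)·N⁻²`, `Crate d = 3γ₀⁻⁶·4d·(π²/12 + 1/3)`, `γ₀ = (4/π²)^{d+2}`),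
   `formDk_rate` (`|⟨B,Δ_{(N)}B⟩ − ⟨B,Δ_{(RN)}B⟩| ≤ Crate(d)·N⁻²·⟨∂₁B,∂₁B⟩` for every `B` on every unit torus —
   no hypothesis at all: the class `p′ = 0` carries `(∂₁B)~(0) = 0`), `formDk_rate_king_shape` (our relative
   form `≤ C·L^{−2k}·⟨B,Δ_kB⟩` in Bałaban's notation — not a printed string —, uniformly in `m`), `w166_limit`
   and `formDk_limit` (the limits `k → ∞` exist with the tails
   `Crate(d)·L^{−2k}`, resp. `·⟨∂₁B,∂₁B⟩`, for `L ≥ 2`).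
§5 `actionReadings` / `actionRate_formDk`: the cell's typed hypothesis shape `T4EtaRateMin.ActionRate`
   DISCHARGED BY NAME for the readings "`⟨B,Δ_kB⟩` of a unit-lattice vector field with `⟨∂₁B,∂₁B⟩ ≤ 1`", rate
   `θ = L⁻²`, constant `Crate(d)`, every `L ≥ 1` — an instance of the SHAPE by the linear one-step object X8 of
   layer NE2⁰, NOT by the minimisers of NE3 (about which nothing is claimed).
§6 THE SECOND PRIMITIVE `ψ₂` OF (1.63) (sibling v1.2 §7, cell GAPS G-ne2p2-2): `psiSum` = the `u`-only squared-
   propagator alias sum `Σ_{l′}|u^{(R)}|²/Δ^{(R)}(·)²` (`psi163_eq`: `ψ₂^{(n)} = Δ₀²·psiSum n` on the zone);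
   `psiSum_mul` — ITS COMPOSITION LAW (`N⁻⁴` weights: `Δ^{(RN)} = N²Δ^{(R)}` squared); `psiSum_le` and
   `one_sub_Psi_bounds` — the SQUARED SCALAR LEMMA 4.2: `0 ≤ 1 − Δ₀(y)²·psiSum R y ≤ (π²/24 + 1/12)·Δ₀(y)`
   uniformly in `R` (`Cpsi = π²/24 + 1/12`); `Psi_rate` — the squared scalar Lemma 4.3:
   `|Δ₀²psiSum (RN) − Δ₀²psiSum N| ≤ Cpsi·Δ₀(p′)·N⁻²`; hence `hpsi_discharged` / `hpsi_king_shape`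
   (`|ψ₂^{(N)} − ψ₂^{(RN)}| ≤ 4d·Cpsi·N⁻²`, the sibling's hypothesis `hψ` as a theorem) and, BY NAME, the
   unconditional `inv_psi163_rate` (`|ψ₂^{(N)}(p′)⁻¹ − ψ₂^{(RN)}(p′)⁻¹| ≤ γ₀⁻²·4d·Cpsi·N⁻²`).  With §4 every
   `p′`-factor of (1.63) typed by the sibling (`Δ₀φ_μ`, its inverses, `ψ₂⁻¹`) now has its `η`-rate with no
   hypothesis; the assembled operator `H_k` (X10) itself is NOT given a rate here (NOT claimed (2)).

## What is NOT claimed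

(1) The identity (1.65) = (1.66) (`⟨B,Δ_kB⟩ = ⟨∂H_kB, ∂H_kB⟩` for the minimiser `H_kB`) is not certified:
`formDk` is DEFINED by the third expression of (1.66), exactly as in `B5Bounds167Lattice` ("What is NOT claimed"
(1) there).  (2) Nothing about the ASSEMBLED objects of the cell's NE2⁰/NE2⁺ layers — the propagator `G` (1.83) as
an operator, `H_k` (1.59)–(1.60)/(1.63) as an operator (only its primitive `p′`-FACTORS `Δ₀φ_μ`, `ψ₂` get rates
here and, by name, in the sibling module), `QGQ*` and `(QGQ*)⁻¹`, `N(p′)⁻¹` of (1.86), the background-field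
propagators of [Balaban1985PropagatorsBackground] — whose η-rates are NOT printed either; they are listed as
precise open inequalities in the seat's record HOME/t4/T4-EST-NE2-P1.md (census), not asserted here.
(3) `phi162`, `w166`, `psi163` carry junk values at `p′ = 0` (division by `Δ₀(0) = 0`, resp. the value `0`);
§1–§4 and §6 are stated on the punctured zone, which is all §5 uses.  (4) No constant is optimal or attributed
to a paper.  (5) Unit-lattice momenta only (`T̃₁`); B5's sizes `n = L^k`, `M_μ = 2L′_μ` are instances of the
arbitrary `N, R ≥ 1`, `M_μ ≥ 1`.
-/

noncomputable section

namespace Literature.MathematicalPhysics.QuantumFieldTheory.Balaban1983to89.B5ActionRate166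

open scoped BigOperators Topology
open Finset Real Filter
open Literature.MathematicalPhysics.QuantumFieldTheory.Balaban1983to89.B4Strip
open Literature.MathematicalPhysics.QuantumFieldTheory.Balaban1983to89.B5Prop11Leaves
open Literature.MathematicalPhysics.QuantumFieldTheory.Balaban1983to89.B5Prop11Fiber
open Literature.MathematicalPhysics.QuantumFieldTheory.Balaban1983to89.B5Prop11Plancherel
open Literature.MathematicalPhysics.QuantumFieldTheory.Balaban1983to89.B5Bounds167Lattice
open Literature.MathematicalPhysics.QuantumFieldTheory.Balaban1983to89.Beta.SymbolExpansion
  (uFactorr_one_zero DeltaXir_one_eq_Delta1r)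

variable {d : ℕ}

/-! ## §0 Elementary facts about the real leaves -/

/- (`n = 1` values of the leaves: `uFactorr 1 0 = 1` on the zone and `DeltaXir 1 0 = Delta1r 0` are the
tree's `Beta.SymbolExpansion.uFactorr_one_zero` / `DeltaXir_one_eq_Delta1r`, used by name.) -/

/-- `Δ₀ = Delta1r 0` is King's `latticeSymbol 1 0`. [folklore] -/
theorem Delta1r_eq_latticeSymbol (s : Fin d → ℝ) : Delta1r 0 s = King1986.latticeSymbol 1 0 s := by
  unfold Delta1r King1986.latticeSymbol
  simp [King1986.S1r_eq_fdSymbol]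

/-- `0 < |y|²` on the punctured zone. [folklore] -/
theorem momSq_pos_of_ne (y : Fin d → ℝ) (ν₀ : Fin d) (hν₀ : y ν₀ ≠ 0) : 0 < King1986.momSq y := by
  unfold King1986.momSq
  have h0 : 0 < y ν₀ ^ 2 := lt_of_le_of_ne (sq_nonneg _) (Ne.symm (pow_ne_zero 2 hν₀))
  exact lt_of_lt_of_le h0 (Finset.single_le_sum (fun ν _ => sq_nonneg (y ν)) (Finset.mem_univ ν₀))

/-- a vector with `0 < |y|²` has a non-zero coordinate. [folklore] -/
theorem exists_ne_zero_of_momSq_pos {y : Fin d → ℝ} (h : 0 < King1986.momSq y) : ∃ ν, y ν ≠ 0 := by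
  by_contra hall
  push Not at hall
  have : King1986.momSq y = 0 := by unfold King1986.momSq; simp [hall]
  linarith

/-- `y_μ² ≤ |y|²`. [folklore] -/
theorem sq_le_momSq (y : Fin d → ℝ) (μ : Fin d) : y μ ^ 2 ≤ King1986.momSq y :=
  Finset.single_le_sum (fun ν _ => sq_nonneg (y ν)) (Finset.mem_univ μ)

/-! ## §1 (1.62) at one step, and the vector Lemma 4.2 -/

/-- at `n = 1` (no averaging step) the sum (1.62) has the single alias `l = 0` and
`φ_μ(p′) = Δ₀(p′)⁻¹` (an evaluation of the printed (1.62), [Balaban1984PropagatorsI] p. 28, kernel-proved).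
[folklore] -/
theorem phi162_one (μ : Fin d) (y : Fin d → ℝ) (hy : ∀ ν, |y ν| ≤ π) :
    phi162 1 μ y = (Delta1r 0 y)⁻¹ := by
  rw [phi162_eq 1 le_rfl μ y hy, Fintype.sum_unique]
  have hk : ∀ ν, (((default : Fin d → Fin 1) ν : Fin 1) : ℕ) = 0 := fun ν => Fin.val_eq_zero _
  have hU : Ur 1 (default : Fin d → Fin 1) y = 1 := by
    unfold Ur
    exact Finset.prod_eq_one fun ν _ => by rw [hk ν]; exact uFactorr_one_zero (hy ν)
  have hsh : shiftr 1 (default : Fin d → Fin 1) y = y := by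
    funext ν; unfold shiftr; rw [hk ν]; simp
  rw [hU, hk μ, uFactorr_one_zero (hy μ), hsh, DeltaXir_one_eq_Delta1r, one_mul, one_div]

/-- **Vector Lemma 4.2** (King's Lemma 4.2 for the Landau-gauge vector symbol (1.62) of
[Balaban1984PropagatorsI], U = 1): on the punctured Brillouin zone, for EVERY number of steps
`n = L^j ≥ 1`, `|φ_μ^{(n)}(y) − Δ₀(y)⁻¹| ≤ π²/12 + 1/3` — the `n`-step symbol stays within a UNIFORM
constant of its `n = 1` value (`phi162_one`).  Upper bound: `|v_μ|² ≤ 1` and King's scalar Lemma 4.2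
(`King1986.lemma42_resc`); lower bound: the `l = 0` term with `|u(y)|² ≥ 1 − |y|²/12`,
`|v_μ(y)|² ≥ 1 − y_μ²/12`, (4.7) and Jordan.  NOT a printed statement (no η-comparison of (1.62) is in
print); elementary real analysis on the printed formula. [folklore] -/
theorem phi162_sub_inv_le (R : ℕ) [NeZero R] (hR : 1 ≤ R) (μ : Fin d) (y : Fin d → ℝ)
    (hy : ∀ ν, |y ν| ≤ π) (hy0 : 0 < King1986.momSq y) :
    |phi162 R μ y - (Delta1r 0 y)⁻¹| ≤ π ^ 2 / 12 + 1 / 3 := by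
  have hR0 : R ≠ 0 := by omega
  have hpi := Real.pi_pos
  obtain ⟨ν₀, hν₀⟩ := exists_ne_zero_of_momSq_pos hy0
  set m : ℝ := King1986.momSq y with hm
  have hm0 : 0 < m := hy0
  have hmnn : 0 ≤ m := hm0.le
  -- the reference `Δ₀(y)⁻¹` versus `|y|⁻²`: (4.7) at `η = 1`
  have href : |(Delta1r 0 y)⁻¹ - m⁻¹| ≤ π ^ 2 / 48 := by
    have h := King1986.latticeSymbol_inv_sub_ref_le' (η := (1 : ℝ)) one_ne_zero (M := 0) le_rfl
      (p := y) (fun μ => by simpa using hy μ)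
    rw [← Delta1r_eq_latticeSymbol, add_zero, one_pow, mul_one] at h
    exact h
  -- UPPER: `φ ≤ Σ_l |u|²/Δ = composedInvResc 0`, then King's Lemma 4.2 (rescaled, `c = 0`, `M̃ = 0`)
  have hU : phi162 R μ y ≤ King1986.composedInvResc 0 R 0 y := by
    rw [phi162_eq R hR μ y hy]
    unfold King1986.composedInvResc
    rw [zero_add]
    refine Finset.sum_le_sum fun k _ => ?_
    rw [div_eq_mul_inv]
    have hU0 := Ur_nonneg R k y
    have hv := uFactorr_le_one R hR (k μ : ℕ) (y μ)
    have hDi : 0 ≤ (DeltaXir R 0 (shiftr R k y))⁻¹ := inv_nonneg.mpr (DeltaXir_nonneg R 0 le_rfl _)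
    calc Ur R k y * uFactorr R (k μ : ℕ) (y μ) * (DeltaXir R 0 (shiftr R k y))⁻¹
        ≤ Ur R k y * 1 * (DeltaXir R 0 (shiftr R k y))⁻¹ :=
          mul_le_mul_of_nonneg_right (mul_le_mul_of_nonneg_left hv hU0) hDi
      _ = Ur R k y * (DeltaXir R 0 (shiftr R k y))⁻¹ := by rw [mul_one]
  have h42 := King1986.lemma42_resc (c := 0) le_rfl hR (Mt := 0) le_rfl hy hm0
  rw [add_zero, zero_add] at h42
  have hUpper : phi162 R μ y ≤ m⁻¹ + π ^ 2 / 48 + 1 / 3 := by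
    have := (abs_sub_le_iff.mp h42).1
    linarith
  -- LOWER: the `l = 0` term
  have hD : 0 < DeltaXir R 0 y := DeltaXir_pos R hR y hy ν₀ hν₀
  have hRinv : ((R : ℝ)⁻¹) ≠ 0 := inv_ne_zero (by exact_mod_cast hR0)
  have hyz : ∀ μ, |(R : ℝ)⁻¹ * y μ| ≤ π := by
    intro μ
    rw [abs_mul, abs_inv, Nat.abs_cast]
    have hR1 : (1 : ℝ) ≤ R := by exact_mod_cast hR
    calc (R : ℝ)⁻¹ * |y μ| ≤ 1 * |y μ| :=
          mul_le_mul_of_nonneg_right (inv_le_one_of_one_le₀ hR1) (abs_nonneg _)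
      _ ≤ π := by rw [one_mul]; exact hy μ
  have hDinv : |(DeltaXir R 0 y)⁻¹ - m⁻¹| ≤ π ^ 2 / 48 := by
    have h := King1986.latticeSymbol_inv_sub_ref_le' hRinv (M := 0) le_rfl (p := y) hyz
    rw [← King1986.DeltaXir_eq_latticeSymbol hR0, add_zero] at h
    have hR1 : ((R : ℝ)⁻¹) ^ 2 ≤ 1 := by
      have hR1 : (1 : ℝ) ≤ R := by exact_mod_cast hR
      have : (R : ℝ)⁻¹ ≤ 1 := inv_le_one_of_one_le₀ hR1
      have h0 : 0 ≤ (R : ℝ)⁻¹ := by positivity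
      nlinarith
    calc |(DeltaXir R 0 y)⁻¹ - m⁻¹| ≤ π ^ 2 / 48 * ((R : ℝ)⁻¹) ^ 2 := h
      _ ≤ π ^ 2 / 48 * 1 := mul_le_mul_of_nonneg_left hR1 (by positivity)
      _ = π ^ 2 / 48 := mul_one _
  have hDjordan : 4 / π ^ 2 * m ≤ DeltaXir R 0 y := by
    have h := King1986.latticeSymbol_ge_jordan hRinv (0 : ℝ) (p := y) hyz
    rw [← King1986.DeltaXir_eq_latticeSymbol hR0, add_zero] at h
    exact h
  -- `(m/6)·D⁻¹ ≤ π²/24`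
  have hmD : m / 6 * (DeltaXir R 0 y)⁻¹ ≤ π ^ 2 / 24 := by
    rw [← div_eq_mul_inv, div_le_iff₀ hD]
    have : m / 6 = π ^ 2 / 24 * (4 / π ^ 2 * m) := by field_simp; ring
    rw [this]
    exact mul_le_mul_of_nonneg_left hDjordan (by positivity)
  -- the head term
  have ha : 1 - m / 12 ≤ Ur R (fun _ => (0 : Fin R)) y := King1986.Ur_zero_ge_one_sub hR hy
  have ha0 : 0 ≤ Ur R (fun _ => (0 : Fin R)) y := Ur_nonneg _ _ _
  have hb : 1 - m / 12 ≤ uFactorr R 0 (y μ) := by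
    have h1 := King1986.uFactorr_zero_ge_one_sub hR (hy μ)
    have h2 : y μ ^ 2 / 12 ≤ m / 12 := by
      have := sq_le_momSq y μ; rw [← hm] at this; linarith
    linarith
  have hb0 : 0 ≤ uFactorr R 0 (y μ) := uFactorr_nonneg _ _ _
  have hab : 1 - m / 6 ≤ Ur R (fun _ => (0 : Fin R)) y * uFactorr R 0 (y μ) := by
    rcases le_or_gt (1 - m / 12) 0 with ht | ht
    · have : 1 - m / 6 ≤ 0 := by linarith
      exact this.trans (mul_nonneg ha0 hb0)
    · calc 1 - m / 6 ≤ (1 - m / 12) * (1 - m / 12) := by nlinarith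
        _ ≤ Ur R (fun _ => (0 : Fin R)) y * uFactorr R 0 (y μ) := mul_le_mul ha hb ht.le ha0
  have hhead : m⁻¹ - π ^ 2 / 48 - π ^ 2 / 24
      ≤ Ur R (fun _ => (0 : Fin R)) y * uFactorr R 0 (y μ) / DeltaXir R 0 y := by
    have hDi : 0 < (DeltaXir R 0 y)⁻¹ := inv_pos.mpr hD
    have h1 : (1 - m / 6) * (DeltaXir R 0 y)⁻¹
        ≤ Ur R (fun _ => (0 : Fin R)) y * uFactorr R 0 (y μ) * (DeltaXir R 0 y)⁻¹ :=
      mul_le_mul_of_nonneg_right hab hDi.le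
    have h2 : (1 - m / 6) * (DeltaXir R 0 y)⁻¹ = (DeltaXir R 0 y)⁻¹ - m / 6 * (DeltaXir R 0 y)⁻¹ := by
      ring
    have h3 := (abs_sub_le_iff.mp hDinv).2
    rw [div_eq_mul_inv (Ur R (fun _ => (0 : Fin R)) y * uFactorr R 0 (y μ))]
    linarith
  have hLower : m⁻¹ - π ^ 2 / 48 - π ^ 2 / 24 ≤ phi162 R μ y := by
    rw [phi162_eq R hR μ y hy]
    have hsum := Finset.single_le_sum (fun k _ => phiMu_term_nonneg R μ y k)
      (Finset.mem_univ (fun _ => (0 : Fin R)))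
    refine le_trans ?_ hsum
    simp only [Fin.val_zero, B5Prop11Leaves.shiftr_zero]
    exact hhead
  -- combine
  rw [abs_le]
  have h1 := (abs_sub_le_iff.mp href).1
  have h2 := (abs_sub_le_iff.mp href).2
  constructor
  · nlinarith [hpi]
  · nlinarith [hpi]

/-! ## §2 The composition law of the alias sum (1.62) (vector form of King's (4.5) = (4.6)∘(4.12)) -/

/-- the real-leaf alias sum of (1.62) at level `R` and an ARBITRARY real momentum `y`:
`Σ_{l′} |u^{(R)}(y+2πl′)|² |v_μ^{(R)}(y+2πl′)|² / Δ^{(R)}(y+2πl′)` (`= φ_μ^{(R)}(y)` on the Brillouin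
zone, `phi162_eq`; off the zone it is the `2π`-periodic continuation). [folklore] -/
def phiSum (R : ℕ) (μ : Fin d) (y : Fin d → ℝ) : ℝ :=
  ∑ l : Fin d → Fin R, Ur R l y * uFactorr R (l μ : ℕ) (y μ) / DeltaXir R 0 (shiftr R l y)

/-- on the zone `phi162 = phiSum`. [folklore] -/
theorem phi162_eq_phiSum (R : ℕ) [NeZero R] (hR : 1 ≤ R) (μ : Fin d) (y : Fin d → ℝ)
    (hy : ∀ ν, |y ν| ≤ π) : phi162 R μ y = phiSum R μ y :=
  phi162_eq R hR μ y hy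

/-- **`2π`-periodicity of the alias sum (1.62)** in each coordinate, away from the two points where
the filled removable singularity of `uFactorr` sits — the inner aliases are re-labelled
`l′ ↦ l′ + χ (mod R)` (the vector analogue of `King1986.composedInvResc_periodic`). [folklore] -/
theorem phiSum_periodic {R : ℕ} [NeZero R] (μ : Fin d) {y : Fin d → ℝ} (χ : Fin d → ℕ)
    (h : ∀ ν, χ ν = 0 ∨ (y ν ≠ 0 ∧ y ν + 2 * π * χ ν ≠ 0)) :
    phiSum R μ (fun ν => y ν + 2 * π * χ ν) = phiSum R μ y := by
  have hR : R ≠ 0 := NeZero.ne R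
  unfold phiSum
  let σ : (Fin d → Fin R) ≃ (Fin d → Fin R) :=
    Equiv.piCongrRight fun ν => Equiv.addRight (Fin.ofNat R (χ ν))
  have hval : ∀ (l : Fin d → Fin R) (ν : Fin d), ((σ l ν : Fin R) : ℕ) = ((l ν : ℕ) + χ ν) % R := by
    intro l ν
    simp [σ, Fin.val_add]
  refine Fintype.sum_equiv σ _ _ fun l => ?_
  have hU : Ur R l (fun ν => y ν + 2 * π * χ ν) = Ur R (σ l) y := by
    unfold Ur
    refine Finset.prod_congr rfl fun ν _ => ?_
    rw [hval l ν]
    exact King1986.uFactorr_shift hR (l ν).isLt (χ ν) (h ν)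
  have hF : uFactorr R (l μ : ℕ) (y μ + 2 * π * χ μ) = uFactorr R ((σ l μ : Fin R) : ℕ) (y μ) := by
    rw [hval l μ]
    exact King1986.uFactorr_shift hR (l μ).isLt (χ μ) (h μ)
  have hB : DeltaXir R 0 (shiftr R l (fun ν => y ν + 2 * π * χ ν))
      = DeltaXir R 0 (shiftr R (σ l) y) := by
    unfold DeltaXir shiftr
    congr 1
    refine Finset.sum_congr rfl fun ν _ => ?_
    rw [hval l ν]
    exact King1986.Sxir_shift hR (l ν) (χ ν) (y ν)
  simp only []
  rw [hU, hF, hB]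

/-- the CENTRED reduced alias momentum: King's symmetric representative `q̃ = symmAlias N l p′` of the
alias `p′ + 2πl` (`|q̃_ν| ≤ πN`, `King1986.CompositionLaw` §3) rescaled to the zone of the `R`-lattice
symbols, `cAlias N l p′ = q̃/N ∈ [−π,π]^d`. [folklore] -/
def cAlias (N : ℕ) (l : Fin d → Fin N) (s : Fin d → ℝ) : Fin d → ℝ :=
  fun ν => King1986.symmAlias N l s ν / N

/-- `cAlias` lies in the Brillouin zone. [folklore] -/
theorem abs_cAlias_le {N : ℕ} (hN : 1 ≤ N) (l : Fin d → Fin N) (s : Fin d → ℝ)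
    (hs : ∀ ν, |s ν| ≤ π) (ν : Fin d) : |cAlias N l s ν| ≤ π := by
  have hN' : (0 : ℝ) < N := by exact_mod_cast (show 0 < N by omega)
  unfold cAlias
  rw [abs_div, abs_of_pos hN', div_le_iff₀ hN']
  exact King1986.symmAlias_abs_le hN l hs ν

/-- `p′ ≠ 0 ⇒ cAlias ≠ 0`. [folklore] -/
theorem cAlias_momSq_pos {N : ℕ} (hN : 1 ≤ N) (l : Fin d → Fin N) {s : Fin d → ℝ}
    (hs : ∀ ν, |s ν| ≤ π) (hs0 : 0 < King1986.momSq s) : 0 < King1986.momSq (cAlias N l s) := by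
  have hN0 : N ≠ 0 := by omega
  have hN' : (0 : ℝ) < N := by exact_mod_cast Nat.pos_of_ne_zero hN0
  have h := King1986.symmAlias_momSq_pos hN l hs hs0
  rw [King1986.momSq_rescale hN0] at h
  unfold cAlias
  exact pos_of_mul_pos_right h (by positivity)

/-- the rescaled uncentred alias momentum `(p′+2πl)/N` is the centred one plus `2π·χ`, `χ = symmShift ∈
{0,1}` the pull-back count. [folklore] -/
theorem shiftr_div_eq_cAlias {N : ℕ} (hN : 1 ≤ N) (l : Fin d → Fin N) (s : Fin d → ℝ) :
    (fun ν => shiftr N l s ν / (N : ℝ))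
      = fun ν => cAlias N l s ν + 2 * π * (King1986.symmShift N l s ν : ℕ) := by
  have hN' : (0 : ℝ) < N := by exact_mod_cast (show 0 < N by omega)
  funext ν; unfold cAlias King1986.symmAlias; field_simp; ring

/-- the periodicity side condition at the centred alias momentum: where the pull-back count is `1`, the
centred coordinate and its shifted copy are both nonzero (they have opposite signs). [folklore] -/
theorem cAlias_shift_cond {N : ℕ} (hN : 1 ≤ N) (l : Fin d → Fin N) {s : Fin d → ℝ}
    (hs : ∀ ν, |s ν| ≤ π) (ν : Fin d) :
    King1986.symmShift N l s ν = 0 ∨ (cAlias N l s ν ≠ 0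
      ∧ cAlias N l s ν + 2 * π * (King1986.symmShift N l s ν : ℕ) ≠ 0) := by
  have hN0 : N ≠ 0 := by omega
  have hN' : (0 : ℝ) < N := by exact_mod_cast Nat.pos_of_ne_zero hN0
  rcases King1986.symmShift_le_one N l s ν with h0 | h1
  · exact Or.inl h0
  · right
    obtain ⟨hlo, hhi⟩ := King1986.shiftr_mem l hs ν
    have hlt : π * N < shiftr N l s ν := by
      unfold King1986.symmShift at h1; split_ifs at h1 with hlt; exact hlt
    have hq : cAlias N l s ν = (shiftr N l s ν - 2 * π * N) / N := by
      unfold cAlias King1986.symmAlias; rw [h1]; push_cast; ring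
    rw [h1, hq]
    push_cast
    constructor
    · have : shiftr N l s ν - 2 * π * N < 0 := by nlinarith [Real.pi_pos]
      exact (div_neg_of_neg_of_pos this hN').ne
    · rw [div_add' _ _ _ hN'.ne', div_ne_zero_iff]
      refine ⟨?_, hN'.ne'⟩
      have hN1 : (1 : ℝ) ≤ N := by exact_mod_cast hN
      nlinarith [Real.pi_pos]

/-- the uncentred rescaled alias momentum `(p′+2πl)/N` and the centred one give the same alias sum
(1.62) at level `R` (periodicity; the pulled-back coordinates avoid the singular points, exactly as in
`King1986.composedInv_symmAlias`). [folklore] -/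
theorem phiSum_cAlias {N R : ℕ} (hN : 1 ≤ N) [NeZero R] (μ : Fin d) (l : Fin d → Fin N)
    {s : Fin d → ℝ} (hs : ∀ ν, |s ν| ≤ π) :
    phiSum R μ (fun ν => shiftr N l s ν / N) = phiSum R μ (cAlias N l s) := by
  rw [shiftr_div_eq_cAlias hN l s]
  exact phiSum_periodic μ (King1986.symmShift N l s) (cAlias_shift_cond hN l hs)

/-- **THE COMPOSITION LAW for (1.62)** (U = 1; the vector form of King's (4.5) = (4.6)∘(4.12)): for
all numbers of steps `N = L^k ≥ 1`, `R = L^n ≥ 1` and every `p′` in the Brillouin zone,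
`φ_μ^{(RN)}(p′) = Σ_l |u^{(N)}(p′+2πl)|² |v_μ^{(N)}(p′+2πl)|² · N⁻² · φ_μ^{(R)}(q̃_l/N)`, `q̃_l` King's
symmetric representative of the alias `p′ + 2πl`.  A finite algebraic identity of the printed
formulas: alias splitting `l″ = l + N l′` (`King1986.aliasSplit`), multiplicativity of the weights
(`King1986.Ur_mul`, `uFactorr_mul`), scaling of the symbol (`King1986.DeltaXir_mul`), periodicity
(`phiSum_cAlias`).  Template: King p. 671 «the composition law for renormalization transformations
allows us to write Δ^{(k+n)}(p′) in the form (4.6), with (4.12)» — stated there for the scalar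
symbol and proved in the tree as `King1986.composition_law`; the vector weight `|v_μ|²` of (1.61) is
multiplicative by the same one-coordinate identity. [folklore] -/
theorem phi162_mul {N R : ℕ} [NeZero N] [NeZero R] (hN : 1 ≤ N) (hR : 1 ≤ R) (μ : Fin d)
    (s : Fin d → ℝ) (hs : ∀ ν, |s ν| ≤ π) :
    phi162 (R * N) μ s = ∑ l : Fin d → Fin N,
      Ur N l s * uFactorr N (l μ : ℕ) (s μ) * ((N : ℝ) ^ 2)⁻¹ * phi162 R μ (cAlias N l s) := by
  have hN0 : N ≠ 0 := by omega
  have hN' : (N : ℝ) ≠ 0 := by exact_mod_cast hN0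
  haveI : NeZero (R * N) := ⟨Nat.mul_ne_zero (NeZero.ne R) hN0⟩
  have hRN : 1 ≤ R * N := Nat.one_le_iff_ne_zero.mpr (NeZero.ne (R * N))
  rw [phi162_eq (R * N) hRN μ s hs, King1986.sum_aliasSplit]
  refine Finset.sum_congr rfl fun l _ => ?_
  rw [phi162_eq_phiSum R hR μ _ (abs_cAlias_le hN l s hs), ← phiSum_cAlias hN μ l hs]
  unfold phiSum
  rw [Finset.mul_sum]
  refine Finset.sum_congr rfl fun l' _ => ?_
  rw [King1986.Ur_mul hN hR l l' hs, King1986.aliasSplit_apply_val,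
    King1986.uFactorr_mul hN hR (l μ).isLt (l' μ) (hs μ), King1986.DeltaXir_mul hN0 0 l l' s,
    zero_div]
  have hy : (s μ + 2 * π * ((l μ : ℕ) : ℝ)) / N = shiftr N l s μ / N := rfl
  rw [hy]
  field_simp

/-! ## §3 The η-rate of (1.62) -/

/-- the explicit constant of the vector Lemma 4.2 / 4.3. [folklore] -/
def Cphi : ℝ := π ^ 2 / 12 + 1 / 3

/-- `0 < Cphi`. [folklore] -/
theorem Cphi_pos : 0 < Cphi := by unfold Cphi; positivity

/-- (1.62) at level `N` through the outer aliases: `φ_μ^{(N)}(p′) = Σ_l |u|²|v_μ|² N⁻² Δ₀(ỹ_l)⁻¹`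
(the composition law at `R = 1`; an identity for the printed (1.62), [Balaban1984PropagatorsI] p. 28,
kernel-proved). [folklore] -/
theorem phi162_eq_sum_cAlias {N : ℕ} [NeZero N] (hN : 1 ≤ N) (μ : Fin d) (s : Fin d → ℝ)
    (hs : ∀ ν, |s ν| ≤ π) :
    phi162 N μ s = ∑ k : Fin d → Fin N,
      Ur N k s * uFactorr N (k μ : ℕ) (s μ) * ((N : ℝ) ^ 2)⁻¹ * (Delta1r 0 (cAlias N k s))⁻¹ := by
  have h := phi162_mul (N := N) (R := 1) hN le_rfl μ s hs
  rw [one_mul] at h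
  rw [h]
  exact Finset.sum_congr rfl fun k _ => by rw [phi162_one μ _ (abs_cAlias_le hN k s hs)]

/-- **Vector Lemma 4.3 / the η-rate of (1.62)** (U = 1): for all `N = L^k ≥ 1`, `R = L^n ≥ 1` and
`p′ ≠ 0` in the Brillouin zone, `|φ_μ^{(RN)}(p′) − φ_μ^{(N)}(p′)| ≤ (π²/12 + 1/3)·N⁻²` — i.e.
`≤ C·L^{−2k}` uniformly in `n`, the form of King's (3.91)/(4.14) for Bałaban's Landau-gauge vector
symbol.  NOT in print. [folklore] -/
theorem phi162_rate {N R : ℕ} [NeZero N] [NeZero R] (hN : 1 ≤ N) (hR : 1 ≤ R) (μ : Fin d)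
    (s : Fin d → ℝ) (hs : ∀ ν, |s ν| ≤ π) (ν₀ : Fin d) (hν₀ : s ν₀ ≠ 0) :
    |phi162 (R * N) μ s - phi162 N μ s| ≤ Cphi * ((N : ℝ) ^ 2)⁻¹ := by
  rw [phi162_mul hN hR μ s hs, phi162_eq_sum_cAlias hN μ s hs, ← Finset.sum_sub_distrib]
  have hN2 : 0 ≤ ((N : ℝ) ^ 2)⁻¹ := by positivity
  have hterm : ∀ k : Fin d → Fin N,
      |Ur N k s * uFactorr N (k μ : ℕ) (s μ) * ((N : ℝ) ^ 2)⁻¹ * phi162 R μ (cAlias N k s)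
        - Ur N k s * uFactorr N (k μ : ℕ) (s μ) * ((N : ℝ) ^ 2)⁻¹ * (Delta1r 0 (cAlias N k s))⁻¹|
      ≤ Ur N k s * (Cphi * ((N : ℝ) ^ 2)⁻¹) := by
    intro k
    have h42 := phi162_sub_inv_le R hR μ (cAlias N k s) (abs_cAlias_le hN k s hs)
      (cAlias_momSq_pos hN k hs (momSq_pos_of_ne s ν₀ hν₀))
    have hw0 : 0 ≤ Ur N k s * uFactorr N (k μ : ℕ) (s μ) * ((N : ℝ) ^ 2)⁻¹ :=
      mul_nonneg (mul_nonneg (Ur_nonneg _ _ _) (uFactorr_nonneg _ _ _)) hN2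
    rw [← mul_sub, abs_mul, abs_of_nonneg hw0]
    have hv : uFactorr N (k μ : ℕ) (s μ) ≤ 1 := uFactorr_le_one N hN _ _
    calc Ur N k s * uFactorr N (k μ : ℕ) (s μ) * ((N : ℝ) ^ 2)⁻¹
          * |phi162 R μ (cAlias N k s) - (Delta1r 0 (cAlias N k s))⁻¹|
        ≤ Ur N k s * 1 * ((N : ℝ) ^ 2)⁻¹ * Cphi := by
          refine mul_le_mul ?_ h42 (abs_nonneg _) ?_
          · exact mul_le_mul_of_nonneg_right
              (mul_le_mul_of_nonneg_left hv (Ur_nonneg _ _ _)) hN2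
          · exact mul_nonneg (mul_nonneg (Ur_nonneg _ _ _) zero_le_one) hN2
      _ = Ur N k s * (Cphi * ((N : ℝ) ^ 2)⁻¹) := by ring
  calc |∑ k : Fin d → Fin N, (Ur N k s * uFactorr N (k μ : ℕ) (s μ) * ((N : ℝ) ^ 2)⁻¹
            * phi162 R μ (cAlias N k s)
          - Ur N k s * uFactorr N (k μ : ℕ) (s μ) * ((N : ℝ) ^ 2)⁻¹ * (Delta1r 0 (cAlias N k s))⁻¹)|
      ≤ ∑ k : Fin d → Fin N, |Ur N k s * uFactorr N (k μ : ℕ) (s μ) * ((N : ℝ) ^ 2)⁻¹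
            * phi162 R μ (cAlias N k s)
          - Ur N k s * uFactorr N (k μ : ℕ) (s μ) * ((N : ℝ) ^ 2)⁻¹ * (Delta1r 0 (cAlias N k s))⁻¹| :=
        Finset.abs_sum_le_sum_abs _ _
    _ ≤ ∑ k : Fin d → Fin N, Ur N k s * (Cphi * ((N : ℝ) ^ 2)⁻¹) := Finset.sum_le_sum fun k _ => hterm k
    _ = Cphi * ((N : ℝ) ^ 2)⁻¹ := by
        rw [← Finset.sum_mul, B5Prop11Leaves.sum_Ur_eq_one N hN s hs, one_mul]

/-- the same for `Δ₀(p′)φ_μ(p′)` (the quantity of the printed sentence «0 < γ₀ ≤ Δ₀(p′)φ_μ(p′) ≤ γ₁», p. 28):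
`|Δ₀φ_μ^{(RN)} − Δ₀φ_μ^{(N)}| ≤ Δ₀(p′)·(π²/12 + 1/3)·N⁻²`. [folklore] -/
theorem Delta0_phi162_rate {N R : ℕ} [NeZero N] [NeZero R] (hN : 1 ≤ N) (hR : 1 ≤ R) (μ : Fin d)
    (s : Fin d → ℝ) (hs : ∀ ν, |s ν| ≤ π) (ν₀ : Fin d) (hν₀ : s ν₀ ≠ 0) :
    |Delta1r 0 s * phi162 (R * N) μ s - Delta1r 0 s * phi162 N μ s|
      ≤ Delta1r 0 s * (Cphi * ((N : ℝ) ^ 2)⁻¹) := by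
  rw [← mul_sub, abs_mul, abs_of_nonneg (Delta1r_nonneg 0 le_rfl s)]
  exact mul_le_mul_of_nonneg_left (phi162_rate hN hR μ s hs ν₀ hν₀) (Delta1r_nonneg 0 le_rfl s)

/-! ## §4 The sibling module's hypothesis `hφ` DISCHARGED: unconditional η-rates of the weight of (1.66),
of `⟨B, Δ_kB⟩`, and their `k → ∞` limits (by name through `T4GaugeActionRate`) -/

/-- the `d`-only constant of the unconditional rates: `3γ₀⁻⁶ · 4d · (π²/12 + 1/3)`, `γ₀ = (4/π²)^{d+2}`
(`T4GaugeActionRate.gam0`). [folklore] -/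
def Crate (d : ℕ) : ℝ := 3 / T4GaugeActionRate.gam0 d ^ 6 * (4 * d * Cphi)

/-- `0 ≤ Crate d`. [folklore] -/
theorem Crate_nonneg (d : ℕ) : 0 ≤ Crate d := by
  unfold Crate; have := Cphi_pos; have := T4GaugeActionRate.gam0_pos d; positivity

/-- **`hφ` of `T4GaugeActionRate` DISCHARGED** (two block sizes `N ≥ 1` and `RN`, `R ≥ 1`; `p′ ≠ 0` in the
zone; every `κ`): `|Δ₀(p′)φ_κ^{(N)}(p′) − Δ₀(p′)φ_κ^{(RN)}(p′)| ≤ 4d·(π²/12 + 1/3)·N⁻²` — the rate of the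
primitive alias sums that every rate theorem of the sibling module `T4GaugeActionRate` carries as its one
explicit hypothesis, now a theorem (`phi162_rate` + `T4GaugeActionRate.hphi_of_phi162_rate`). [folklore] -/
theorem hphi_discharged {N R : ℕ} [NeZero N] [NeZero R] (hN : 1 ≤ N) (hR : 1 ≤ R) (s : Fin d → ℝ)
    (hs : ∀ κ, |s κ| ≤ π) (ν₀ : Fin d) (hν₀ : s ν₀ ≠ 0) (κ : Fin d) :
    |Delta1r 0 s * phi162 N κ s - Delta1r 0 s * phi162 (R * N) κ s|
      ≤ 4 * d * (Cphi * ((N : ℝ) ^ 2)⁻¹) :=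
  T4GaugeActionRate.hphi_of_phi162_rate N (R * N) s
    (fun κ => by rw [abs_sub_comm]; exact phi162_rate hN hR κ s hs ν₀ hν₀) κ

/-- the same in King's `(k, k+m)` indexing with `N = L^k`, `R = L^m` (`L ≥ 1`): `|Δ₀φ_κ^{(L^k)} − Δ₀φ_κ^{(L^{k+m})}|
≤ 4d·(π²/12 + 1/3)·L^{−2k}` — literally the hypothesis `hφ` of `T4GaugeActionRate.formDk_rate_king_shape`,
`w166_limit`, `formDk_limit` with `C_φ = 4d(π²/12 + 1/3)`. [folklore] -/
theorem hphi_king_shape (L : ℕ) (hL : 1 ≤ L) (s : Fin d → ℝ) (hs : ∀ κ, |s κ| ≤ π) (ν₀ : Fin d)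
    (hν₀ : s ν₀ ≠ 0) (k m : ℕ) (κ : Fin d) :
    |Delta1r 0 s * phi162 (L ^ k) κ s - Delta1r 0 s * phi162 (L ^ (k + m)) κ s|
      ≤ 4 * d * Cphi * ((L : ℝ) ^ k)⁻¹ ^ 2 := by
  have hL0 : L ≠ 0 := by omega
  haveI : NeZero (L ^ k) := ⟨pow_ne_zero k hL0⟩
  haveI : NeZero (L ^ m) := ⟨pow_ne_zero m hL0⟩
  have h := hphi_discharged (N := L ^ k) (R := L ^ m) (Nat.one_le_pow k L (by omega))
    (Nat.one_le_pow m L (by omega)) s hs ν₀ hν₀ κ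
  have hpow : L ^ m * L ^ k = L ^ (k + m) := by rw [pow_add, mul_comm]
  rw [hpow] at h
  calc |Delta1r 0 s * phi162 (L ^ k) κ s - Delta1r 0 s * phi162 (L ^ (k + m)) κ s|
      ≤ 4 * d * (Cphi * ((((L ^ k : ℕ) : ℝ)) ^ 2)⁻¹) := h
    _ = 4 * d * Cphi * ((L : ℝ) ^ k)⁻¹ ^ 2 := by push_cast; rw [← inv_pow]; ring

/-- **THE η-RATE OF THE WEIGHT OF (1.66), UNCONDITIONAL**: for `N, R ≥ 1` and `p′ ≠ 0` in the zone,
`|w^{(N)}_{μν}(p′) − w^{(RN)}_{μν}(p′)| ≤ Crate(d)·N⁻²` (the sibling's `w166_rate_of_phi162_rate` with `hφ`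
discharged).  Printed nowhere for Bałaban's `Δ_k`; the printed scalar template is King's (3.91)/(4.18).
[folklore] -/
theorem w166_rate {N R : ℕ} [NeZero N] [NeZero R] (hN : 1 ≤ N) (hR : 1 ≤ R) (μ ν : Fin d)
    (s : Fin d → ℝ) (hs : ∀ κ, |s κ| ≤ π) (ν₀ : Fin d) (hν₀ : s ν₀ ≠ 0) :
    |w166 N μ ν s - w166 (R * N) μ ν s| ≤ Crate d * ((N : ℝ) ^ 2)⁻¹ := by
  haveI : NeZero (R * N) := ⟨Nat.mul_ne_zero (NeZero.ne R) (NeZero.ne N)⟩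
  have hRN : 1 ≤ R * N := Nat.one_le_iff_ne_zero.mpr (NeZero.ne (R * N))
  have h := T4GaugeActionRate.w166_rate_of_phi162_rate N (R * N) hN hRN μ ν s hs ν₀ hν₀
    (fun κ => hphi_discharged hN hR s hs ν₀ hν₀ κ)
  calc |w166 N μ ν s - w166 (R * N) μ ν s|
      ≤ 3 / T4GaugeActionRate.gam0 d ^ 6 * (4 * d * (Cphi * ((N : ℝ) ^ 2)⁻¹)) := h
    _ = Crate d * ((N : ℝ) ^ 2)⁻¹ := by unfold Crate; ring

section Form

variable (M : Fin d → ℕ) [hM : ∀ μ, NeZero (M μ)]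

/-- **THE η-RATE OF BAŁABAN'S U(1) EFFECTIVE GAUGE-FIELD ACTION, UNCONDITIONAL** (form (1.66)): for every unit
torus `T₁`, every vector field `B`, all `N, R ≥ 1`, `|⟨B, Δ_{(N)}B⟩ − ⟨B, Δ_{(RN)}B⟩| ≤ Crate(d)·N⁻²·⟨∂₁B,∂₁B⟩`
— no hypothesis (the class `p′ = 0`, where the typed weight carries a junk value, has `(∂₁B)~(0) = 0`).  The
sibling's `formDk_rate_of_phi162_rate` with `hφ` discharged.  Printed nowhere (T4-XREAD-U1a X8 «none printed»);
King's scalar (3.92) p. 669 is the template. [folklore] -/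
theorem formDk_rate {N R : ℕ} [NeZero N] [NeZero R] (hN : 1 ≤ N) (hR : 1 ≤ R) (B : Tor M × Fin d → ℂ) :
    |formDk N M B - formDk (R * N) M B| ≤ Crate d * ((N : ℝ) ^ 2)⁻¹ * d1Sq M B := by
  haveI : NeZero (R * N) := ⟨Nat.mul_ne_zero (NeZero.ne R) (NeZero.ne N)⟩
  have hRN : 1 ≤ R * N := Nat.one_le_iff_ne_zero.mpr (NeZero.ne (R * N))
  have hθ : 0 ≤ 4 * d * (Cphi * ((N : ℝ) ^ 2)⁻¹) := by have := Cphi_pos; positivity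
  have h := T4GaugeActionRate.formDk_rate_of_phi162_rate M N (R * N) hN hRN B hθ
    (fun p hp κ => by
      obtain ⟨ν₀, hν₀⟩ := Function.ne_iff.mp hp
      exact hphi_discharged hN hR (sOf M p) (abs_sOf_le M p) ν₀ hν₀ κ)
  calc |formDk N M B - formDk (R * N) M B|
      ≤ 3 / T4GaugeActionRate.gam0 d ^ 6 * (4 * d * (Cphi * ((N : ℝ) ^ 2)⁻¹)) * d1Sq M B := h
    _ = Crate d * ((N : ℝ) ^ 2)⁻¹ * d1Sq M B := by unfold Crate; ring

/-- **King's (3.91)/(3.92) shape for the U(1) gauge-field action, UNCONDITIONAL**: for `L ≥ 2` and all `k, m`,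
`|⟨B,(Δ_k − Δ_{k+m})B⟩| ≤ (3γ₀⁻⁷·4d(π²/12 + 1/3))·L^{−2k}·⟨B,Δ_kB⟩` — the sibling's `formDk_rate_king_shape`
(whose `L^{−2k}` hypothesis was DISPLAYED there) with the hypothesis now proved (`hphi_king_shape`).  The
printed SCALAR statement is [King1986, Prop. 3.10 (3.91)–(3.92) p. 669]; this is printed nowhere. [folklore] -/
theorem formDk_rate_king_shape (L k m : ℕ) (hL : 2 ≤ L) (B : Tor M × Fin d → ℂ) :
    |formDk (L ^ k) M B - formDk (L ^ (k + m)) M B|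
      ≤ 3 / T4GaugeActionRate.gam0 d ^ 7 * (4 * d * Cphi) * ((L : ℝ) ^ k)⁻¹ ^ 2 * formDk (L ^ k) M B := by
  have hC : 0 ≤ 4 * d * Cphi := by have := Cphi_pos; positivity
  exact T4GaugeActionRate.formDk_rate_king_shape M L k m hL B hC
    (fun p hp κ => by
      obtain ⟨ν₀, hν₀⟩ := Function.ne_iff.mp hp
      exact hphi_king_shape L (by omega) (sOf M p) (abs_sOf_le M p) ν₀ hν₀ k m κ)

/-- **the multiplier of `Δ_k` CONVERGES as `k → ∞` at every `p′ ≠ 0`, rate `L^{−2k}`, UNCONDITIONALLY**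
(`L ≥ 2`): `w_∞(p′) := lim_k w^{(L^k)}_{μν}(p′)` exists, `|w^{(L^k)} − w_∞| ≤ Crate(d)·L^{−2k}` for every `k`,
`w_∞ ≥ γ₀` (the sibling's `w166_limit`, `hφ` discharged). [folklore] -/
theorem w166_limit (L : ℕ) (hL : 2 ≤ L) (μ ν : Fin d) (s : Fin d → ℝ) (hs : ∀ κ, |s κ| ≤ π)
    (ν₀ : Fin d) (hν₀ : s ν₀ ≠ 0) :
    ∃ winf : ℝ, Tendsto (fun k => w166 (L ^ k) μ ν s) atTop (𝓝 winf)
      ∧ (∀ k, |w166 (L ^ k) μ ν s - winf| ≤ Crate d * ((L : ℝ) ^ k)⁻¹ ^ 2)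
      ∧ T4GaugeActionRate.gam0 d ≤ winf := by
  obtain ⟨winf, ht, hb, hγ⟩ := T4GaugeActionRate.w166_limit L hL μ ν s hs ν₀ hν₀ (Cφ := 4 * d * Cphi)
    (fun k m κ => hphi_king_shape L (by omega) s hs ν₀ hν₀ k m κ)
  refine ⟨winf, ht, fun k => ?_, hγ⟩
  calc |w166 (L ^ k) μ ν s - winf|
      ≤ 3 / T4GaugeActionRate.gam0 d ^ 6 * (4 * d * Cphi) * ((L : ℝ) ^ k)⁻¹ ^ 2 := hb k
    _ = Crate d * ((L : ℝ) ^ k)⁻¹ ^ 2 := by unfold Crate; ring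

/-- **the U(1) effective action `⟨B, Δ_kB⟩` CONVERGES as `k → ∞`, rate `L^{−2k}`, UNCONDITIONALLY, for every
vector field `B` on every unit torus** (`L ≥ 2`): `|⟨B,Δ_kB⟩ − F_∞(B)| ≤ Crate(d)·L^{−2k}·⟨∂₁B,∂₁B⟩` (the
sibling's `formDk_limit`, `hφ` discharged) — the unit-scale `η → 0` limit WITH ITS RATE of the ONE printed
linear object X8 of the cell's layer NE2⁰; printed nowhere; NOT summit progress. [folklore] -/
theorem formDk_limit (L : ℕ) (hL : 2 ≤ L) (B : Tor M × Fin d → ℂ) :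
    ∃ Finf : ℝ, Tendsto (fun k => formDk (L ^ k) M B) atTop (𝓝 Finf)
      ∧ ∀ k, |formDk (L ^ k) M B - Finf| ≤ Crate d * ((L : ℝ) ^ k)⁻¹ ^ 2 * d1Sq M B := by
  have hC : 0 ≤ 4 * d * Cphi := by have := Cphi_pos; positivity
  obtain ⟨Finf, ht, hb⟩ := T4GaugeActionRate.formDk_limit M L hL B hC
    (fun k m p hp κ => by
      obtain ⟨ν₀, hν₀⟩ := Function.ne_iff.mp hp
      exact hphi_king_shape L (by omega) (sOf M p) (abs_sOf_le M p) ν₀ hν₀ k m κ)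
  refine ⟨Finf, ht, fun k => ?_⟩
  calc |formDk (L ^ k) M B - Finf|
      ≤ 3 / T4GaugeActionRate.gam0 d ^ 6 * (4 * d * Cphi) * ((L : ℝ) ^ k)⁻¹ ^ 2 * d1Sq M B := hb k
    _ = Crate d * ((L : ℝ) ^ k)⁻¹ ^ 2 * d1Sq M B := by unfold Crate; ring

end Form

/-! ## §5 Liaison with the T4 spine's typed hypothesis shape `T4EtaRateMin.ActionRate` -/

section Liaison

variable (L : ℕ) (M : Fin d → ℕ) [hM : ∀ μ, NeZero (M μ)]

/-- the U(1) effective actions as READINGS in the sense of `T4EtaRateMin`: datum = a unit-lattice vector field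
`B` with `⟨∂₁B,∂₁B⟩ ≤ 1`, scalar reading of the `k`-step run = `⟨B,Δ_kB⟩` (form (1.66) at `n = L^k`), no local
readings, volume factor `1`.  This instantiates the SHAPE with the LINEAR one-step object X8 of layer NE2⁰ —
NOT with the minimisers of NE3, about which nothing is claimed. [folklore] -/
def actionReadings : T4EtaRateMin.Readings (Tor M × Fin d → ℂ) Unit where
  dom := {B | d1Sq M B ≤ 1}
  act := fun k B => formDk (L ^ k) M B
  loc := fun _ _ _ => 0
  vol := 1
  vol_nonneg := zero_le_one

/-- **`T4EtaRateMin.ActionRate` BY NAME for the U(1) effective actions**, rate `θ = L⁻²`, constant `Crate(d)`,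
for every `L ≥ 1` and every unit torus: `|⟨B,Δ_{k+1}B⟩ − ⟨B,Δ_kB⟩| ≤ Crate(d)·(L⁻²)^k` on `⟨∂₁B,∂₁B⟩ ≤ 1`.
[folklore] -/
theorem actionRate_formDk (hL : 1 ≤ L) :
    T4EtaRateMin.ActionRate (actionReadings L M) (Crate d) (((L : ℝ) ^ 2)⁻¹) := by
  intro k B hB
  have hL0 : L ≠ 0 := by omega
  haveI : NeZero (L ^ k) := ⟨pow_ne_zero k hL0⟩
  haveI : NeZero L := ⟨hL0⟩
  have hB' : d1Sq M B ≤ 1 := hB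
  have h := formDk_rate M (N := L ^ k) (R := L) (Nat.one_le_pow k L (by omega)) hL B
  have hpow : L * L ^ k = L ^ (k + 1) := by rw [pow_succ, mul_comm]
  rw [hpow] at h
  have hcast : (((L ^ k : ℕ) : ℝ) ^ 2)⁻¹ = (((L : ℝ) ^ 2)⁻¹) ^ k := by
    push_cast
    rw [← pow_mul, mul_comm k 2, pow_mul, inv_pow]
  rw [hcast] at h
  have h0 : 0 ≤ Crate d * (((L : ℝ) ^ 2)⁻¹) ^ k := mul_nonneg (Crate_nonneg d) (by positivity)
  show |formDk (L ^ (k + 1)) M B - formDk (L ^ k) M B| ≤ Crate d * (((L : ℝ) ^ 2)⁻¹) ^ k * 1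
  rw [abs_sub_comm]
  calc |formDk (L ^ k) M B - formDk (L ^ (k + 1)) M B|
      ≤ Crate d * (((L : ℝ) ^ 2)⁻¹) ^ k * d1Sq M B := h
    _ ≤ Crate d * (((L : ℝ) ^ 2)⁻¹) ^ k * 1 := mul_le_mul_of_nonneg_left hB' h0

end Liaison

/-! ## §6 The SECOND PRIMITIVE alias sum of (1.63), `ψ₂(p′) = Σ_{l″}|u(p′+l″)|²Δ₀²(p′)/Δ²(p′+l″)`:
composition law, the squared scalar Lemma 4.2, the η-rate — the sibling's hypothesis `hψ` DISCHARGED -/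

/-- the `u`-only squared-propagator alias sum at level `R` and an arbitrary real momentum `y`:
`Σ_{l′} |u^{(R)}(y+2πl′)|² / Δ^{(R)}(y+2πl′)²` — so that the typed (1.63) sum is `ψ₂^{(n)}(p′) =
Δ₀(p′)²·psiSum n p′` on the zone (`psi163_eq`). [folklore] -/
def psiSum (R : ℕ) (y : Fin d → ℝ) : ℝ :=
  ∑ l : Fin d → Fin R, Ur R l y / DeltaXir R 0 (shiftr R l y) ^ 2

/-- `0 ≤ psiSum`. [folklore] -/
theorem psiSum_nonneg (R : ℕ) (y : Fin d → ℝ) : 0 ≤ psiSum R y :=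
  Finset.sum_nonneg fun l _ => div_nonneg (Ur_nonneg R l y) (sq_nonneg _)

/-- on the Brillouin zone the typed second primitive of (1.63), `T4GaugeActionRate.psi163 n` (B5 p. 28
prints the normalising factor «(Σ_{l″}|u(p′ + l″)|²Δ₀²(p′)/Δ²(p′ + l″))⁻¹» in the second term of the
momentum representation of `H_kB`), equals `Δ₀(p′)²·psiSum n p′` (`‖uSym‖² = Ur`, tree `norm_uSym_sq`;
an identity for the printed (1.63), [Balaban1984PropagatorsI] p. 28, kernel-proved). [folklore] -/
theorem psi163_eq (n : ℕ) [NeZero n] (hn : 1 ≤ n) (s : Fin d → ℝ) (hs : ∀ ν, |s ν| ≤ π) :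
    T4GaugeActionRate.psi163 n s = Delta1r 0 s ^ 2 * psiSum n s := by
  unfold T4GaugeActionRate.psi163 psiSum
  rw [Finset.mul_sum]
  refine Finset.sum_congr rfl fun k _ => ?_
  rw [norm_uSym_sq n hn k s hs]
  ring

/-- at `n = 1`: `psiSum 1 y = (Δ₀(y)²)⁻¹` on the zone (single alias). [folklore] -/
theorem psiSum_one (y : Fin d → ℝ) (hy : ∀ ν, |y ν| ≤ π) : psiSum 1 y = (Delta1r 0 y ^ 2)⁻¹ := by
  unfold psiSum
  rw [Fintype.sum_unique]
  have hk : ∀ ν, (((default : Fin d → Fin 1) ν : Fin 1) : ℕ) = 0 := fun ν => Fin.val_eq_zero _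
  have hU : Ur 1 (default : Fin d → Fin 1) y = 1 := by
    unfold Ur
    exact Finset.prod_eq_one fun ν _ => by rw [hk ν]; exact uFactorr_one_zero (hy ν)
  have hsh : shiftr 1 (default : Fin d → Fin 1) y = y := by
    funext ν; unfold shiftr; rw [hk ν]; simp
  rw [hU, hsh, DeltaXir_one_eq_Delta1r, one_div]

/-- `2π`-periodicity of `psiSum` in each coordinate away from the filled singular points (as
`phiSum_periodic`: re-label the inner aliases `l′ ↦ l′ + χ (mod R)`). [folklore] -/
theorem psiSum_periodic {R : ℕ} [NeZero R] {y : Fin d → ℝ} (χ : Fin d → ℕ)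
    (h : ∀ ν, χ ν = 0 ∨ (y ν ≠ 0 ∧ y ν + 2 * π * χ ν ≠ 0)) :
    psiSum R (fun ν => y ν + 2 * π * χ ν) = psiSum R y := by
  have hR : R ≠ 0 := NeZero.ne R
  unfold psiSum
  let σ : (Fin d → Fin R) ≃ (Fin d → Fin R) :=
    Equiv.piCongrRight fun ν => Equiv.addRight (Fin.ofNat R (χ ν))
  have hval : ∀ (l : Fin d → Fin R) (ν : Fin d), ((σ l ν : Fin R) : ℕ) = ((l ν : ℕ) + χ ν) % R := by
    intro l ν
    simp [σ, Fin.val_add]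
  refine Fintype.sum_equiv σ _ _ fun l => ?_
  have hU : Ur R l (fun ν => y ν + 2 * π * χ ν) = Ur R (σ l) y := by
    unfold Ur
    refine Finset.prod_congr rfl fun ν _ => ?_
    rw [hval l ν]
    exact King1986.uFactorr_shift hR (l ν).isLt (χ ν) (h ν)
  have hB : DeltaXir R 0 (shiftr R l (fun ν => y ν + 2 * π * χ ν))
      = DeltaXir R 0 (shiftr R (σ l) y) := by
    unfold DeltaXir shiftr
    congr 1
    refine Finset.sum_congr rfl fun ν _ => ?_
    rw [hval l ν]
    exact King1986.Sxir_shift hR (l ν) (χ ν) (y ν)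
  try simp only []
  rw [hU, hB]

/-- uncentred = centred rescaled alias momentum in `psiSum` (as `phiSum_cAlias`). [folklore] -/
theorem psiSum_cAlias {N R : ℕ} (hN : 1 ≤ N) [NeZero R] (l : Fin d → Fin N)
    {s : Fin d → ℝ} (hs : ∀ ν, |s ν| ≤ π) :
    psiSum R (fun ν => shiftr N l s ν / N) = psiSum R (cAlias N l s) := by
  rw [shiftr_div_eq_cAlias hN l s]
  exact psiSum_periodic (King1986.symmShift N l s) (cAlias_shift_cond hN l hs)

/-- **THE COMPOSITION LAW for the second primitive of (1.63)**: for `N, R ≥ 1` and `p′` in the zone,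
`psiSum (RN) p′ = Σ_l |u^{(N)}(p′+2πl)|² · N⁻⁴ · psiSum R (q̃_l/N)` (alias splitting, `|u|²` multiplicative,
`Δ^{(RN)}(p′+2πl″) = N²Δ^{(R)}(·)` SQUARED gives `N⁻⁴`, periodicity).  King's §4 method on the printed
formula; not in print. [folklore] -/
theorem psiSum_mul {N R : ℕ} [NeZero N] [NeZero R] (hN : 1 ≤ N) (hR : 1 ≤ R)
    (s : Fin d → ℝ) (hs : ∀ ν, |s ν| ≤ π) :
    psiSum (R * N) s = ∑ l : Fin d → Fin N,
      Ur N l s * ((N : ℝ) ^ 4)⁻¹ * psiSum R (cAlias N l s) := by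
  have hN0 : N ≠ 0 := by omega
  have hN' : (N : ℝ) ≠ 0 := by exact_mod_cast hN0
  show (∑ l'' : Fin d → Fin (R * N), Ur (R * N) l'' s / DeltaXir (R * N) 0 (shiftr (R * N) l'' s) ^ 2) = _
  rw [King1986.sum_aliasSplit]
  refine Finset.sum_congr rfl fun l _ => ?_
  rw [← psiSum_cAlias hN l hs]
  unfold psiSum
  rw [Finset.mul_sum]
  refine Finset.sum_congr rfl fun l' _ => ?_
  rw [King1986.Ur_mul hN hR l l' hs, King1986.DeltaXir_mul hN0 0 l l' s, zero_div]
  have h4 : ((N : ℝ) ^ 4)⁻¹ = ((N : ℝ) ^ 2)⁻¹ * ((N : ℝ) ^ 2)⁻¹ := by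
    rw [← mul_inv, ← pow_add]
  rw [h4, mul_pow, div_mul_eq_div_div]
  field_simp

/-- upper bound `psiSum R y ≤ (Δ₀(y)²)⁻¹` on the punctured zone, every `R ≥ 1` (`Δ₀(y) ≤ Δ^{(R)}(y+2πl′)`,
tree `Delta1r_le_DeltaXir_shift`; `Σ_{l′}|u|² = 1`, E4). [folklore] -/
theorem psiSum_le (R : ℕ) [NeZero R] (hR : 1 ≤ R) (y : Fin d → ℝ) (hy : ∀ ν, |y ν| ≤ π)
    (ν₀ : Fin d) (hν₀ : y ν₀ ≠ 0) : psiSum R y ≤ (Delta1r 0 y ^ 2)⁻¹ := by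
  have hΔ : 0 < Delta1r 0 y := Delta1r_pos y hy ν₀ hν₀
  unfold psiSum
  calc ∑ l : Fin d → Fin R, Ur R l y / DeltaXir R 0 (shiftr R l y) ^ 2
      ≤ ∑ l : Fin d → Fin R, Ur R l y / Delta1r 0 y ^ 2 := by
        refine Finset.sum_le_sum fun l _ => ?_
        exact div_le_div_of_nonneg_left (Ur_nonneg R l y) (pow_pos hΔ 2)
          (pow_le_pow_left₀ hΔ.le (Delta1r_le_DeltaXir_shift R hR l y) 2)
    _ = (Delta1r 0 y ^ 2)⁻¹ := by
        rw [← Finset.sum_div, B5Prop11Leaves.sum_Ur_eq_one R hR y hy, one_div]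

/-- the explicit constant of the squared scalar Lemma 4.2 / 4.3. [folklore] -/
def Cpsi : ℝ := π ^ 2 / 24 + 1 / 12

/-- `0 < Cpsi`. [folklore] -/
theorem Cpsi_pos : 0 < Cpsi := by unfold Cpsi; positivity

/-- **the squared scalar Lemma 4.2**: on the punctured zone, for EVERY `R ≥ 1`,
`0 ≤ 1 − Δ₀(y)²·psiSum R y ≤ (π²/24 + 1/12)·Δ₀(y)` — the normalised second primitive `Ψ^{(R)} = Δ₀²ψ`
is `1 − O(|y|²)` UNIFORMLY in `R` (head term `l′ = 0`: `|u^{(R)}(y)|² ≥ 1 − |y|²/12`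
(`King1986.Ur_zero_ge_one_sub`), `Δ^{(R)}(y) ≤ |y|²`, `Δ₀(y) ≤ |y|²`, and (4.7) at `η = 1`:
`|y|² − Δ₀(y) ≤ (π²/48)·Δ₀(y)|y|²`).  Not in print. [folklore] -/
theorem one_sub_Psi_bounds (R : ℕ) [NeZero R] (hR : 1 ≤ R) (y : Fin d → ℝ) (hy : ∀ ν, |y ν| ≤ π)
    (ν₀ : Fin d) (hν₀ : y ν₀ ≠ 0) :
    0 ≤ 1 - Delta1r 0 y ^ 2 * psiSum R y
      ∧ 1 - Delta1r 0 y ^ 2 * psiSum R y ≤ Cpsi * Delta1r 0 y := by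
  have hR0 : R ≠ 0 := by omega
  have hpi := Real.pi_pos
  have hm0 : 0 < King1986.momSq y := momSq_pos_of_ne y ν₀ hν₀
  have hΔ0 : 0 < Delta1r 0 y := Delta1r_pos y hy ν₀ hν₀
  set m : ℝ := King1986.momSq y with hm
  set Δ : ℝ := Delta1r 0 y with hΔdef
  -- `Δ₀ ≤ |y|²`
  have hΔm : Δ ≤ m := by
    have h := King1986.latticeSymbol_le (η := (1 : ℝ)) one_ne_zero (0 : ℝ) y
    rw [← Delta1r_eq_latticeSymbol, add_zero] at h
    exact h
  -- (4.7) at `η = 1`: `|y|² − Δ₀ ≤ (π²/48)Δ₀|y|²`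
  have h47 : m - Δ ≤ π ^ 2 / 48 * Δ * m := by
    have h := King1986.latticeSymbol_inv_sub_ref_le' (η := (1 : ℝ)) one_ne_zero (M := 0) le_rfl
      (p := y) (fun μ => by simpa using hy μ)
    rw [← Delta1r_eq_latticeSymbol, add_zero, one_pow, mul_one] at h
    have h1 := (abs_le.mp h).2
    have h2 : Δ⁻¹ - m⁻¹ = (m - Δ) / (Δ * m) := by
      field_simp
    rw [h2, div_le_iff₀ (mul_pos hΔ0 hm0)] at h1
    linarith
  refine ⟨?_, ?_⟩
  · have h := psiSum_le R hR y hy ν₀ hν₀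
    have h2 : Δ ^ 2 * psiSum R y ≤ Δ ^ 2 * (Δ ^ 2)⁻¹ := mul_le_mul_of_nonneg_left h (sq_nonneg _)
    rw [mul_inv_cancel₀ (pow_ne_zero 2 hΔ0.ne')] at h2
    linarith
  · -- `Δ^{(R)}(y) ≤ |y|²`
    have hD : 0 < DeltaXir R 0 y := DeltaXir_pos R hR y hy ν₀ hν₀
    have hRinv : ((R : ℝ)⁻¹) ≠ 0 := inv_ne_zero (by exact_mod_cast hR0)
    have hDm : DeltaXir R 0 y ≤ m := by
      have h := King1986.latticeSymbol_le (η := (R : ℝ)⁻¹) hRinv (0 : ℝ) y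
      rw [← King1986.DeltaXir_eq_latticeSymbol hR0, add_zero] at h
      exact h
    -- the head term `l′ = 0`
    have ha : 1 - m / 12 ≤ Ur R (fun _ => (0 : Fin R)) y := King1986.Ur_zero_ge_one_sub hR hy
    have ha0 : 0 ≤ Ur R (fun _ => (0 : Fin R)) y := Ur_nonneg _ _ _
    have hhead : (1 - m / 12) / m ^ 2 ≤ Ur R (fun _ => (0 : Fin R)) y / DeltaXir R 0 y ^ 2 := by
      rcases le_or_gt 0 (1 - m / 12) with ht | ht
      · calc (1 - m / 12) / m ^ 2 ≤ (1 - m / 12) / DeltaXir R 0 y ^ 2 :=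
              div_le_div_of_nonneg_left ht (pow_pos hD 2) (pow_le_pow_left₀ hD.le hDm 2)
          _ ≤ Ur R (fun _ => (0 : Fin R)) y / DeltaXir R 0 y ^ 2 :=
              div_le_div_of_nonneg_right ha (sq_nonneg _)
      · exact (div_neg_of_neg_of_pos ht (by positivity)).le.trans (div_nonneg ha0 (sq_nonneg _))
    have hpsi : (1 - m / 12) / m ^ 2 ≤ psiSum R y := by
      unfold psiSum
      have hsum := Finset.single_le_sum
        (fun (l : Fin d → Fin R) _ => div_nonneg (Ur_nonneg R l y) (sq_nonneg (DeltaXir R 0 (shiftr R l y))))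
        (Finset.mem_univ (fun _ => (0 : Fin R)))
      refine le_trans ?_ hsum
      simp only [B5Prop11Leaves.shiftr_zero]
      exact hhead
    -- algebra: `1 − Δ²(1 − m/12)/m² ≤ (π²/24 + 1/12)Δ`
    have e1 : m ^ 2 - Δ ^ 2 ≤ π ^ 2 / 24 * Δ * m ^ 2 := by
      have hfac : m ^ 2 - Δ ^ 2 = (m - Δ) * (m + Δ) := by ring
      rw [hfac]
      calc (m - Δ) * (m + Δ) ≤ (π ^ 2 / 48 * Δ * m) * (m + Δ) :=
            mul_le_mul_of_nonneg_right h47 (by positivity)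
        _ ≤ (π ^ 2 / 48 * Δ * m) * (2 * m) :=
            mul_le_mul_of_nonneg_left (by linarith) (by positivity)
        _ = π ^ 2 / 24 * Δ * m ^ 2 := by ring
    have e2 : Δ ^ 2 * m ≤ Δ * m ^ 2 := by
      have : 0 ≤ Δ * m * (m - Δ) := mul_nonneg (mul_nonneg hΔ0.le hm0.le) (sub_nonneg.mpr hΔm)
      nlinarith
    have e3 : 1 - Cpsi * Δ ≤ Δ ^ 2 * ((1 - m / 12) / m ^ 2) := by
      rw [show Δ ^ 2 * ((1 - m / 12) / m ^ 2) = (Δ ^ 2 * (1 - m / 12)) / m ^ 2 by ring,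
        le_div_iff₀ (by positivity : (0 : ℝ) < m ^ 2)]
      unfold Cpsi
      nlinarith [e1, e2]
    have e4 : Δ ^ 2 * ((1 - m / 12) / m ^ 2) ≤ Δ ^ 2 * psiSum R y :=
      mul_le_mul_of_nonneg_left hpsi (sq_nonneg _)
    linarith

/-- `N²·Δ₀(q̃_l/N) = Δ^{(N)}(p′+2πl)`: the unit-lattice symbol at the centred reduced alias momentum is the
`N`-lattice symbol at the alias (scaling + `2πN`-periodicity, `King1986.DeltaXir_symmAlias`). [folklore] -/
theorem sq_mul_Delta1r_cAlias {N : ℕ} (hN : 1 ≤ N) (l : Fin d → Fin N) (s : Fin d → ℝ) :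
    ((N : ℝ) ^ 2) * Delta1r 0 (cAlias N l s) = DeltaXir N 0 (shiftr N l s) := by
  have hN0 : N ≠ 0 := by omega
  have hN' : (N : ℝ) ≠ 0 := by exact_mod_cast hN0
  rw [← King1986.DeltaXir_symmAlias hN0 0 l s]
  unfold Delta1r DeltaXir cAlias
  rw [add_zero, add_zero, Finset.mul_sum]
  refine Finset.sum_congr rfl fun ν _ => ?_
  rw [S1r_eq, Sxir_eq]
  have : King1986.symmAlias N l s ν / (N : ℝ) / 2 = King1986.symmAlias N l s ν / (2 * N) := by
    rw [div_div, mul_comm]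
  rw [this]
  ring

/-- **η-RATE OF THE NORMALISED SECOND PRIMITIVE** `Ψ^{(n)}(p′) = Δ₀(p′)²·psiSum n p′` (the squared scalar
Lemma 4.3): for `N, R ≥ 1` and `p′ ≠ 0` in the zone, `|Ψ^{(RN)}(p′) − Ψ^{(N)}(p′)| ≤ (π²/24 + 1/12)·Δ₀(p′)·N⁻²`
— uniformly `≤ 4d(π²/24 + 1/12)·N⁻²` on the punctured zone AND vanishing as `p′ → 0`.  King's method: the
composition law twice (`RN = R·N`, `N = 1·N`), weights `|u|²Δ₀(p′)²/(N⁴Δ₀(q̃_l/N)²)`, the squared scalar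
Lemma 4.2 at each `q̃_l/N`, and `N²Δ₀(q̃_l/N) = Δ^{(N)}(p′+2πl) ≥ Δ₀(p′)`.  Not in print. [folklore] -/
theorem Psi_rate {N R : ℕ} [NeZero N] [NeZero R] (hN : 1 ≤ N) (hR : 1 ≤ R)
    (s : Fin d → ℝ) (hs : ∀ ν, |s ν| ≤ π) (ν₀ : Fin d) (hν₀ : s ν₀ ≠ 0) :
    |Delta1r 0 s ^ 2 * psiSum (R * N) s - Delta1r 0 s ^ 2 * psiSum N s|
      ≤ Cpsi * Delta1r 0 s * ((N : ℝ) ^ 2)⁻¹ := by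
  have hN0 : N ≠ 0 := by omega
  have hN' : (N : ℝ) ≠ 0 := by exact_mod_cast hN0
  have hΔ0 : 0 < Delta1r 0 s := Delta1r_pos s hs ν₀ hν₀
  have hC := Cpsi_pos
  have hN1 : psiSum N s = ∑ l : Fin d → Fin N,
      Ur N l s * ((N : ℝ) ^ 4)⁻¹ * (Delta1r 0 (cAlias N l s) ^ 2)⁻¹ := by
    have h := psiSum_mul (N := N) (R := 1) hN le_rfl s hs
    rw [one_mul] at h
    rw [h]
    exact Finset.sum_congr rfl fun l _ => by rw [psiSum_one _ (abs_cAlias_le hN l s hs)]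
  rw [psiSum_mul hN hR s hs, hN1, Finset.mul_sum, Finset.mul_sum, ← Finset.sum_sub_distrib]
  have hterm : ∀ l : Fin d → Fin N,
      |Delta1r 0 s ^ 2 * (Ur N l s * ((N : ℝ) ^ 4)⁻¹ * psiSum R (cAlias N l s))
        - Delta1r 0 s ^ 2 * (Ur N l s * ((N : ℝ) ^ 4)⁻¹ * (Delta1r 0 (cAlias N l s) ^ 2)⁻¹)|
      ≤ Ur N l s * (Cpsi * Delta1r 0 s * ((N : ℝ) ^ 2)⁻¹) := by
    intro l
    have hcz : ∀ ν, |cAlias N l s ν| ≤ π := abs_cAlias_le hN l s hs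
    have hc0 : 0 < King1986.momSq (cAlias N l s) :=
      cAlias_momSq_pos hN l hs (momSq_pos_of_ne s ν₀ hν₀)
    obtain ⟨ν₁, hν₁⟩ := exists_ne_zero_of_momSq_pos hc0
    have hΔc : 0 < Delta1r 0 (cAlias N l s) := Delta1r_pos _ hcz ν₁ hν₁
    obtain ⟨hlo, hhi⟩ := one_sub_Psi_bounds R hR (cAlias N l s) hcz ν₁ hν₁
    have hbig : Delta1r 0 s ≤ (N : ℝ) ^ 2 * Delta1r 0 (cAlias N l s) := by
      rw [sq_mul_Delta1r_cAlias hN l s]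
      exact Delta1r_le_DeltaXir_shift N hN l s
    have hw0 : 0 ≤ Ur N l s := Ur_nonneg _ _ _
    have hW0 : 0 ≤ Delta1r 0 s ^ 2 * ((N : ℝ) ^ 4)⁻¹ * (Delta1r 0 (cAlias N l s) ^ 2)⁻¹ := by
      positivity
    have halg : Delta1r 0 s ^ 2 * (Ur N l s * ((N : ℝ) ^ 4)⁻¹ * psiSum R (cAlias N l s))
        - Delta1r 0 s ^ 2 * (Ur N l s * ((N : ℝ) ^ 4)⁻¹ * (Delta1r 0 (cAlias N l s) ^ 2)⁻¹)
        = -(Ur N l s * ((Delta1r 0 s ^ 2 * ((N : ℝ) ^ 4)⁻¹ * (Delta1r 0 (cAlias N l s) ^ 2)⁻¹)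
            * (1 - Delta1r 0 (cAlias N l s) ^ 2 * psiSum R (cAlias N l s)))) := by
      field_simp
      ring
    rw [halg, abs_neg, abs_of_nonneg (mul_nonneg hw0 (mul_nonneg hW0 hlo))]
    have hratio : Delta1r 0 s / ((N : ℝ) ^ 2 * Delta1r 0 (cAlias N l s)) ≤ 1 := by
      rw [div_le_one (by positivity)]
      exact hbig
    have hW : Delta1r 0 s ^ 2 * ((N : ℝ) ^ 4)⁻¹ * (Delta1r 0 (cAlias N l s) ^ 2)⁻¹
          * (Cpsi * Delta1r 0 (cAlias N l s))
        ≤ Cpsi * Delta1r 0 s * ((N : ℝ) ^ 2)⁻¹ := by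
      calc Delta1r 0 s ^ 2 * ((N : ℝ) ^ 4)⁻¹ * (Delta1r 0 (cAlias N l s) ^ 2)⁻¹
            * (Cpsi * Delta1r 0 (cAlias N l s))
          = Cpsi * Delta1r 0 s * ((N : ℝ) ^ 2)⁻¹
              * (Delta1r 0 s / ((N : ℝ) ^ 2 * Delta1r 0 (cAlias N l s))) := by
            field_simp
        _ ≤ Cpsi * Delta1r 0 s * ((N : ℝ) ^ 2)⁻¹ * 1 :=
            mul_le_mul_of_nonneg_left hratio (by positivity)
        _ = Cpsi * Delta1r 0 s * ((N : ℝ) ^ 2)⁻¹ := mul_one _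
    calc Ur N l s * ((Delta1r 0 s ^ 2 * ((N : ℝ) ^ 4)⁻¹ * (Delta1r 0 (cAlias N l s) ^ 2)⁻¹)
            * (1 - Delta1r 0 (cAlias N l s) ^ 2 * psiSum R (cAlias N l s)))
        ≤ Ur N l s * ((Delta1r 0 s ^ 2 * ((N : ℝ) ^ 4)⁻¹ * (Delta1r 0 (cAlias N l s) ^ 2)⁻¹)
            * (Cpsi * Delta1r 0 (cAlias N l s))) :=
          mul_le_mul_of_nonneg_left (mul_le_mul_of_nonneg_left hhi hW0) hw0
      _ ≤ Ur N l s * (Cpsi * Delta1r 0 s * ((N : ℝ) ^ 2)⁻¹) := mul_le_mul_of_nonneg_left hW hw0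
  calc |∑ l : Fin d → Fin N, (Delta1r 0 s ^ 2 * (Ur N l s * ((N : ℝ) ^ 4)⁻¹ * psiSum R (cAlias N l s))
          - Delta1r 0 s ^ 2 * (Ur N l s * ((N : ℝ) ^ 4)⁻¹ * (Delta1r 0 (cAlias N l s) ^ 2)⁻¹))|
      ≤ ∑ l : Fin d → Fin N, |Delta1r 0 s ^ 2 * (Ur N l s * ((N : ℝ) ^ 4)⁻¹ * psiSum R (cAlias N l s))
          - Delta1r 0 s ^ 2 * (Ur N l s * ((N : ℝ) ^ 4)⁻¹ * (Delta1r 0 (cAlias N l s) ^ 2)⁻¹)| :=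
        Finset.abs_sum_le_sum_abs _ _
    _ ≤ ∑ l : Fin d → Fin N, Ur N l s * (Cpsi * Delta1r 0 s * ((N : ℝ) ^ 2)⁻¹) :=
        Finset.sum_le_sum fun l _ => hterm l
    _ = Cpsi * Delta1r 0 s * ((N : ℝ) ^ 2)⁻¹ := by
        rw [← Finset.sum_mul, B5Prop11Leaves.sum_Ur_eq_one N hN s hs, one_mul]

/-- **`hψ` of `T4GaugeActionRate` (cell GAPS G-ne2p2-2) DISCHARGED**: for `N, R ≥ 1`, `p′ ≠ 0` in the zone,
`|ψ₂^{(N)}(p′) − ψ₂^{(RN)}(p′)| ≤ 4d(π²/24 + 1/12)·N⁻²` for the typed second primitive `psi163` of (1.63).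
[folklore] -/
theorem hpsi_discharged {N R : ℕ} [NeZero N] [NeZero R] (hN : 1 ≤ N) (hR : 1 ≤ R) (s : Fin d → ℝ)
    (hs : ∀ ν, |s ν| ≤ π) (ν₀ : Fin d) (hν₀ : s ν₀ ≠ 0) :
    |T4GaugeActionRate.psi163 N s - T4GaugeActionRate.psi163 (R * N) s|
      ≤ 4 * d * Cpsi * ((N : ℝ) ^ 2)⁻¹ := by
  haveI : NeZero (R * N) := ⟨Nat.mul_ne_zero (NeZero.ne R) (NeZero.ne N)⟩
  have hRN : 1 ≤ R * N := Nat.one_le_iff_ne_zero.mpr (NeZero.ne (R * N))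
  rw [psi163_eq N hN s hs, psi163_eq (R * N) hRN s hs, abs_sub_comm]
  have hC := Cpsi_pos
  calc |Delta1r 0 s ^ 2 * psiSum (R * N) s - Delta1r 0 s ^ 2 * psiSum N s|
      ≤ Cpsi * Delta1r 0 s * ((N : ℝ) ^ 2)⁻¹ := Psi_rate hN hR s hs ν₀ hν₀
    _ ≤ Cpsi * (4 * d) * ((N : ℝ) ^ 2)⁻¹ :=
        mul_le_mul_of_nonneg_right (mul_le_mul_of_nonneg_left (Delta1r_le s) hC.le) (by positivity)
    _ = 4 * d * Cpsi * ((N : ℝ) ^ 2)⁻¹ := by ring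

/-- the same in King's `(k, k+m)` indexing, `N = L^k`, `R = L^m`, `L ≥ 1`:
`|ψ₂^{(L^k)} − ψ₂^{(L^{k+m})}| ≤ 4d(π²/24 + 1/12)·L^{−2k}`. [folklore] -/
theorem hpsi_king_shape (L : ℕ) (hL : 1 ≤ L) (s : Fin d → ℝ) (hs : ∀ ν, |s ν| ≤ π) (ν₀ : Fin d)
    (hν₀ : s ν₀ ≠ 0) (k m : ℕ) :
    |T4GaugeActionRate.psi163 (L ^ k) s - T4GaugeActionRate.psi163 (L ^ (k + m)) s|
      ≤ 4 * d * Cpsi * ((L : ℝ) ^ k)⁻¹ ^ 2 := by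
  have hL0 : L ≠ 0 := by omega
  haveI : NeZero (L ^ k) := ⟨pow_ne_zero k hL0⟩
  haveI : NeZero (L ^ m) := ⟨pow_ne_zero m hL0⟩
  have h := hpsi_discharged (N := L ^ k) (R := L ^ m) (Nat.one_le_pow k L (by omega))
    (Nat.one_le_pow m L (by omega)) s hs ν₀ hν₀
  have hpow : L ^ m * L ^ k = L ^ (k + m) := by rw [pow_add, mul_comm]
  rw [hpow] at h
  calc |T4GaugeActionRate.psi163 (L ^ k) s - T4GaugeActionRate.psi163 (L ^ (k + m)) s|
      ≤ 4 * d * Cpsi * ((((L ^ k : ℕ) : ℝ)) ^ 2)⁻¹ := h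
    _ = 4 * d * Cpsi * ((L : ℝ) ^ k)⁻¹ ^ 2 := by push_cast; rw [← inv_pow]

/-- **the inverse factor `ψ₂(p′)⁻¹` of (1.63) moves at rate `N⁻²`, UNCONDITIONALLY**: the sibling's
`inv_psi163_rate` with `hψ` discharged — `|ψ₂^{(N)}(p′)⁻¹ − ψ₂^{(RN)}(p′)⁻¹| ≤ γ₀⁻²·4d(π²/24 + 1/12)·N⁻²`.
With the sibling's `inverse_factors_rate` (its §3, fed by `hphi_discharged`) every inverse `p′`-factor
of (1.63) now has its `η`-rate with no hypothesis left. [folklore] -/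
theorem inv_psi163_rate {N R : ℕ} [NeZero N] [NeZero R] (hN : 1 ≤ N) (hR : 1 ≤ R) (s : Fin d → ℝ)
    (hs : ∀ ν, |s ν| ≤ π) (ν₀ : Fin d) (hν₀ : s ν₀ ≠ 0) :
    |1 / T4GaugeActionRate.psi163 N s - 1 / T4GaugeActionRate.psi163 (R * N) s|
      ≤ 1 / T4GaugeActionRate.gam0 d ^ 2 * (4 * d * Cpsi * ((N : ℝ) ^ 2)⁻¹) := by
  haveI : NeZero (R * N) := ⟨Nat.mul_ne_zero (NeZero.ne R) (NeZero.ne N)⟩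
  have hRN : 1 ≤ R * N := Nat.one_le_iff_ne_zero.mpr (NeZero.ne (R * N))
  exact T4GaugeActionRate.inv_psi163_rate N (R * N) hN hRN s hs ν₀ hν₀
    (hpsi_discharged hN hR s hs ν₀ hν₀)

end Literature.MathematicalPhysics.QuantumFieldTheory.Balaban1983to89.B5ActionRate166

end
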